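import Summits.QuantumFields.BalabanUV.Beta.GAN24.RespStepBmGaugeStep

/-!
# `BalabanUV.Beta.GAN24.RespStepConstraint` — binder row G-an2-4 ∕ (CONV-C), PART V «SREC», RULINGS-16 (R16-2) «SREC-QPI»:
# THE NORMALISATION OF an2's `respStep` ON ITS OWN BLOCKING — one further `Lc`-contour sum of the `b`-weighted level-(m, m+1) response legs
# gives back `b` EXACTLY: **`κ_m = 1`** (said plainly, as the ruling asks: it IS a short composition of tree lemmas)

NOT IN PRINT; OUR BOOKKEEPING ([folklore] kernel algebra).  HONEST FRAMING (cell contract, verbatim): «discharging `BetaPertH` makes Bałaban's UV stability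
UNCONDITIONAL — a real constructive-QFT result; it is NOT the continuum limit and NOT the Clay problem.»  HONEST DEPENDENCY (verbatim): «continuum YM on T⁴ ⇐
BetaPertH ∧ nine spine estimates (0/9 proved); BetaPertH ⇐ (D1) ∧ (D4) ∧ CAP+tail; G-an2-4 gates asym, D1 and NE2/3/4.»

THE IDENTITY AND WHY `κ_m = 1`.  an2's response leg is `respStep M N′ μ z := 𝒬_M ℋ_{N′}(·; μ, z)` (`BalabanCompositeJets.respStep`, the `M`-block contour sum
of an5's level-`N′` minimiser column `ResolventComposition.Hcol`).  For `M = Lc^m`, `N′ = Lc^(m+1)`: one further `Lc`-contour sum in level-`m` coordinates is the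
level-`(m+1)` contour sum (`ResolventComposition.contourSum_mul`: `𝒬_{M·L} = 𝒬_L ∘ 𝒬_M`, and `Lc^(m+1) = Lc^m · Lc`), and `𝒬_{N′} ℋ_{N′}(·; μ, z) = δ_{(μ,z)}`
(`ResolventComposition.contourSum_Hcol`, «𝒬ℋ = 1»).  Hence, for every weight `b` with `∀ μ, Summable (b μ)`,
`𝒬_{Lc} (l w ↦ Σ_μ Σ'_z b μ z · respStep (Lc^m) (Lc^(m+1)) μ z l w) = b` — the ruling's `κ_m • b` with **`κ_m = 1` in the raw `respStep` units** (any unit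
factor the consumer V4-c `RespStepBmDecomp` carries is a displayed scalar on its side; nothing is hidden here).
CONTENT (general `d`, any `Lc ≥ 1`, any `m`).
* §0 **`contourSum_weighted_respStep`** — the ruling's identity (`κ_m = 1`); `weighted_respStep_eq_contourSum` (the `b`-weighted leg series IS the `Lc^m`-contour
  sum of the `b`-weighted column series — `contourSum_tsum` + `summable_mul_Hcol`).
* §1 **`contourSum_respStep`** — the single-leg form `𝒬_{Lc} (respStep (Lc^m) (Lc^(m+1)) μ z) l w = [w = z ∧ l = μ]`; `sum_contourSum_respStep` (finitely weighted).
0 `def`, 0 cite, 0 sorry; discharges NOTHING of (hS, hSall); NEVER «G-an2-4 closed»; NOT D1, NOT BetaPertH, NOT continuum, NOT Clay.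
ABSOLUTE RULE (cell, verbatim): «No internally-minted statement may enter as a cited fact. Every hypothesis is either kernel-proved in this package or a
verbatim quotation of a PUBLISHED theorem with page reference.»  Nothing cited; every input is a tree theorem BY NAME.
Provenance: unit `b2b-balaban-gan24-formalise-leaf-02` (gen 33; idle G-an2-4 swarm leaf seat; journal CLAIM «SREC-QPI» 2026-08-20T17:26:51Z), row owner gan24-p1.
-/

noncomputable section

open Finset
open scoped BigOperators
open Literature.MathematicalPhysics.QuantumFieldTheory
open Literature.MathematicalPhysics.QuantumFieldTheory.Balaban1983to89
open Literature.MathematicalPhysics.QuantumFieldTheory.Balaban1983to89.Beta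
open AffineAveraging (Form1 Site contourSum)
open ResolventComposition (Hcol contourSum_tsum contourSum_const_mul contourSum_finset_sum contourSum_mul contourSum_Hcol)
open BalabanCompositeJets (respStep)
open Summit.QuantumFields.BalabanUV.Beta.GAN24.RespStepBmGaugeStep (summable_mul_Hcol)

namespace Summit.QuantumFields.BalabanUV.Beta.GAN24.RespStepConstraint

variable {d : ℕ} (Lc : ℕ) [NeZero Lc] (m : ℕ)

/-! ## §1 The single leg: `𝒬_{Lc} ∘ 𝒬_{Lc^m} = 𝒬_{Lc^{m+1}}` and «𝒬ℋ = 1» -/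

/-- [folklore] `respStep M N′ μ z` IS the `M`-contour sum of the column `ℋ_{N′}(·; μ, z)` (definitional). -/
theorem respStep_eq_contourSum_Hcol (M N' : ℕ) [NeZero N'] (μ : Fin (d + 1)) (z : Site (d + 1)) :
    respStep (d := d) M N' μ z = contourSum M (Hcol (N := N') (d := d) μ z) := rfl

/-- [folklore] **THE SINGLE-LEG NORMALISATION**: `𝒬_{Lc} (respStep (Lc^m) (Lc^(m+1)) μ z) l w = [w = z ∧ l = μ]` — one further `Lc`-contour sum of the
level-(m, m+1) response leg in level-`m` coordinates is the level-`(m+1)` contour sum of the level-`(m+1)` minimiser column, which is the Kronecker datum. -/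
theorem contourSum_respStep (μ : Fin (d + 1)) (z : Site (d + 1)) (l : Fin (d + 1)) (w : Site (d + 1)) :
    contourSum Lc (respStep (d := d) (Lc ^ m) (Lc ^ (m + 1)) μ z) l w = if w = z ∧ l = μ then 1 else 0 := by
  have hM : 0 < Lc ^ m := pow_pos (Nat.pos_of_ne_zero (NeZero.ne Lc)) m
  rw [respStep_eq_contourSum_Hcol, ← congrFun (congrFun (contourSum_mul (Lc ^ m) Lc hM (Hcol (N := Lc ^ (m + 1)) (d := d) μ z)) l) w,
    ← pow_succ, contourSum_Hcol]

/-- [folklore] Finitely weighted form: `𝒬_{Lc} (l w ↦ Σ_{t ∈ T} c t · respStep (Lc^m) (Lc^(m+1)) t.1 t.2 l w) l w = Σ_{t ∈ T} c t · [w = t.2 ∧ l = t.1]`. -/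
theorem sum_contourSum_respStep (T : Finset (Fin (d + 1) × Site (d + 1))) (c : Fin (d + 1) × Site (d + 1) → ℝ)
    (l : Fin (d + 1)) (w : Site (d + 1)) :
    contourSum Lc (fun l w => ∑ t ∈ T, c t * respStep (d := d) (Lc ^ m) (Lc ^ (m + 1)) t.1 t.2 l w) l w
      = ∑ t ∈ T, c t * (if w = t.2 ∧ l = t.1 then 1 else 0) := by
  rw [contourSum_finset_sum]
  refine Finset.sum_congr rfl fun t _ => ?_
  rw [contourSum_const_mul, contourSum_respStep]

/-! ## §0 The ruling's identity: `κ_m = 1` -/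

/-- [folklore] The `b`-weighted series of response legs IS the `Lc^m`-contour sum of the `b`-weighted series of columns (`contourSum_tsum`, summability by
`RespStepBmGaugeStep.summable_mul_Hcol`). -/
theorem weighted_respStep_eq_contourSum {b : Fin (d + 1) → Site (d + 1) → ℝ} (hb : ∀ μ, Summable (b μ)) (μ : Fin (d + 1))
    (κ : Fin (d + 1)) (x : Site (d + 1)) :
    (∑' z, b μ z * respStep (d := d) (Lc ^ m) (Lc ^ (m + 1)) μ z κ x)
      = contourSum (Lc ^ m) (fun κ' x' => ∑' z, b μ z * Hcol (N := Lc ^ (m + 1)) (d := d) μ z κ' x') κ x := by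
  rw [contourSum_tsum (L := Lc ^ m) (fun z κ' x' => b μ z * Hcol (N := Lc ^ (m + 1)) (d := d) μ z κ' x')
    (fun κ' x' => summable_mul_Hcol (hb μ) μ κ' x')]
  refine tsum_congr fun z => ?_
  rw [contourSum_const_mul]
  rfl

/-- [folklore] **(R16-2) «SREC-QPI» — THE NORMALISATION OF `respStep` ON ITS OWN BLOCKING, `κ_m = 1`**: for every `Lc ≥ 1`, `m`, and every weight
`b : Fin (d+1) → Site (d+1) → ℝ` with `∀ μ, Summable (b μ)`,
`contourSum Lc (fun l w => Σ_μ Σ'_z b μ z · respStep (Lc^m) (Lc^(m+1)) μ z l w) l w = b l w`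
(`𝒬_{Lc} ∘ 𝒬_{Lc^m} = 𝒬_{Lc^{m+1}}` by `contourSum_mul`; `𝒬_{Lc^{m+1}} ℋ_{Lc^{m+1}}(·; μ, z) = δ_{(μ,z)}` by `contourSum_Hcol`). -/
theorem contourSum_weighted_respStep {b : Fin (d + 1) → Site (d + 1) → ℝ} (hb : ∀ μ, Summable (b μ)) (l : Fin (d + 1)) (w : Site (d + 1)) :
    contourSum Lc (fun l w => ∑ μ, ∑' z, b μ z * respStep (d := d) (Lc ^ m) (Lc ^ (m + 1)) μ z l w) l w = b l w := by
  have hM : 0 < Lc ^ m := pow_pos (Nat.pos_of_ne_zero (NeZero.ne Lc)) m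
  -- the summability of each weighted column series (fine variables) and of each weighted leg series (level-`m` variables)
  have hcol : ∀ μ κ' x', Summable fun z => b μ z * Hcol (N := Lc ^ (m + 1)) (d := d) μ z κ' x' :=
    fun μ κ' x' => summable_mul_Hcol (hb μ) μ κ' x'
  -- rewrite each leg series as a contour sum of the column series, then nest the contour sums
  have e : (fun l w => ∑ μ, ∑' z, b μ z * respStep (d := d) (Lc ^ m) (Lc ^ (m + 1)) μ z l w)
      = fun l w => ∑ μ ∈ Finset.univ, contourSum (Lc ^ m)
          (fun κ' x' => ∑' z, b μ z * Hcol (N := Lc ^ (m + 1)) (d := d) μ z κ' x') l w := by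
    funext l w
    exact Finset.sum_congr rfl fun μ _ => weighted_respStep_eq_contourSum Lc m hb μ l w
  rw [e, contourSum_finset_sum]
  have step : ∀ μ, contourSum Lc (contourSum (Lc ^ m)
      (fun κ' x' => ∑' z, b μ z * Hcol (N := Lc ^ (m + 1)) (d := d) μ z κ' x')) l w = if l = μ then b μ w else 0 := by
    intro μ
    rw [← congrFun (congrFun (contourSum_mul (Lc ^ m) Lc hM _) l) w, ← pow_succ,
      contourSum_tsum (L := Lc ^ (m + 1)) (fun z κ' x' => b μ z * Hcol (N := Lc ^ (m + 1)) (d := d) μ z κ' x') (hcol μ)]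
    have inner : ∀ z, contourSum (Lc ^ (m + 1)) (fun κ' x' => b μ z * Hcol (N := Lc ^ (m + 1)) (d := d) μ z κ' x') l w
        = b μ z * (if w = z ∧ l = μ then 1 else 0) := by
      intro z
      rw [contourSum_const_mul, contourSum_Hcol]
    simp_rw [inner]
    by_cases hl : l = μ
    · subst hl
      simp only [and_true, if_true]
      rw [tsum_eq_single w (fun z hz => by simp [Ne.symm hz])]
      simp
    · simp [hl]
  simp_rw [step]
  simp [Finset.sum_ite_eq]

end Summit.QuantumFields.BalabanUV.Beta.GAN24.RespStepConstraint

end
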